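import Literature.MathematicalPhysics.QuantumFieldTheory.Balaban1983to89.B4StripSums
import Literature.MathematicalPhysics.QuantumFieldTheory.Balaban1983to89.B4TorusKernel

/-!
# `Balaban1983to89.B4Torus248Decay` — the torus joiner for B4 (2.48): `j`-, mass-, offset- and VOLUME-uniform exponential decay
# of the FINITE-TORUS kernel of `G_j Q_j^*` (B4 Lemma 2.4 (2.35), first quantity, on the torus)

T. Bałaban, *Regularity and decay of lattice Green's functions*, Commun. Math. Phys. **89**, 571–597 (1983)
[Balaban1983RegularityDecay] (cell paper B4): p. 572 [PDF 2] (the torus `T_η`, verbatim: *"which we identify with a rectangular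
parallelepiped in ηZ^d with periodic conditions"*), p. 582 [PDF 12] Lemma 2.4 (2.35), p. 584–585 [PDF 14–15] (2.43)–(2.48),
p. 586 [PDF 16] l. 9–15; T. Bałaban, *Propagators and renormalization transformations for lattice gauge theories. I*, Commun. Math.
Phys. **95**, 17–40 (1984) [Balaban1984PropagatorsI] (cell paper B5): p. 23 [PDF 7] (1.29) (Fourier transform on a torus),
p. 25 [PDF 9] l. 35–36, p. 36 [PDF 20] l. 20–23.

CITATION HEADER (lean-in-tree rule 2026-08-18).  This module is a SUPPLEMENT, not a quotation.  B4 proves Lemma 2.4 — p. 582,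
verbatim: *"(2.35) |(G_j(□)Q_j^*)(x,y)|, |(∂^{L^{−j}}_μ G_j(□)Q_j^*)(x,y)| ≤ c₀e^{−δ₀|x−y|} … for arbitrary non-negative integer j"* —
through the momentum formula on the INFINITE lattice `ξZ^d`, p. 585 (2.48), verbatim:
*"(G_jQ_j^*)(x,y) = (2π)^{−d}∫_{|p'|≤π}dp' Σ_l e^{i(p'+l)·(x−y)} [a_jΣ_{l'}|u_j(p'+l')|²/Δ^ξ(p'+l') + 1]^{−1} u_j(p'+l)/Δ^ξ(p'+l)"*,
and the complex shift of p. 586 l. 9–15 (*"It is more troublesome, but equally elementary, to prove that this neighbourhood can be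
chosen independently of j and that the expression is bounded also in this neighbourhood. Shifting the domain of integration …"*).
The later papers use the same operators ON A TORUS and dispose of the finite volume by reference: B5 p. 25 l. 35–36, verbatim:
*"It is a translation invariant operator on the unit lattice T₁^{(k)} and its Fourier transform can be written using formula (2.48)"*,
and p. 36 l. 20–23, verbatim: *"Probably the simplest proof of the exponential decay properties can be obtained by relating G on the
torus to G on the whole lattice ηZ^d in the usual way"*.  Neither paper writes the finite-torus argument for (2.48).

The cell supplies it in kernel modules, both IMPORTED here untouched:
* `B4StripSums` (b04-g4, p179241): the regrouped `l`-sum of (2.48) at block offset `τ`, `G n a m2 τ : ℂ^{d+1} → ℂ`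
  (`n = L^j = ξ⁻¹`; fine point `x = x⁰ + τ/n`, `x⁰ ∈ ℤ^{d+1}`, `τ ∈ {0..n−1}^{d+1}`; unit point `y`; the kernel of (2.48) is
  `latticeKernel (G n a m2 τ) (x⁰ − y)`), is `B4ContourShift.StripRegular` with constants UNIFORM in `n ≥ 1`, `a ∈ [a₋,a₊]`,
  `m² ∈ [0,m²₊]`, `τ` — `multiplier248_stripRegular`, hypothesis `0 < a₋` only;
* `B4TorusKernel` (pv17): for a strip-regular multiplier the torus kernel sampled at the dual-torus momenta `2π rep(k_μ/N_μ)` IS the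
  periodisation `Σ_m K(x + (N_μm_μ)_μ)` of its lattice kernel (Poisson summation on `Π_μ ℤ/N_μ`, `MultiPeriod.torusKernel_descend_eq`)
  and decays at rate `κ/(d+1)` in the TORUS METRIC with constant `M · periodConst κ d`, uniformly in the period vector
  (`MultiPeriod.torusKernel_descend_decay_torusMetric`).

THIS FILE (journal node G-B4-02a-TORUS248-JOINER of the cell `pub-balaban`) composes them:
* `torusKernel248 n a m2 τ N x⁰ = (Π_μ N_μ)⁻¹ Σ_{k ∈ Π_μ ℤ/N_μ} G_{n,a,m²,τ}(2π rep(k/N)) Π_μ e^{2πi k_μ x⁰_μ/N_μ}` — the (2.48) formula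
  with the lattice inversion `(2π)^{−d}∫dp′` replaced by the torus inversion of B5 (1.29) / B4 (2.43)-on-`T` (dual momenta
  `p′_μ = 2π rep(k_μ/N_μ) ∈ (2π/N_μ)ℤ ∩ [−π,π)`), on the unit torus `T₁^{(j)} = Π_μ ℤ/N_μ` of `N_μ ≥ 1` unit blocks per direction
  (the fine torus `T_ξ` has `nN_μ` points per direction); an explicit finite sum, no proof terms inside the statement;
* `torusKernel248_eq_torusKernel` — it is `B4TorusKernel.MultiPeriod.torusKernel (descendC (G n a m2 τ) …) N x⁰` (definitional);
* `torusKernel248_translate` — `N_μ`-periodicity in each `x⁰_μ`;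
* `torusKernel248_eq_periodise` — for `a > 0`, `m² ≥ 0`: `torusKernel248 n a m2 τ N x⁰ = Σ_{m ∈ ℤ^{d+1}} latticeKernel (G n a m2 τ)
  (x⁰ + (N_μ m_μ)_μ)` ("relating G on the torus to G on the whole lattice … in the usual way": the torus kernel of `G_jQ_j^*` is the
  periodisation of the infinite-volume kernel of (2.48));
* **`kernel248_torusKernel_decay_torusMetric (ha : 0 < a₋)`** — `∃ κ > 0, M ≥ 0, ∀ n ≥ 1, ∀ a ∈ [a₋,a₊], ∀ m² ∈ [0,m²₊], ∀ τ,
  ∀ N (all N_μ ≥ 1), ∀ x⁰ ∈ ℤ^{d+1}: ‖torusKernel248 n a m2 τ N x⁰‖ ≤ M · periodConst κ d · e^{−(κ/(d+1)) · torusSupNorm N x⁰}`,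
  `MultiPeriod.torusSupNorm N x⁰ = max_μ dist(x⁰_μ, N_μℤ)` — B4 (2.35), first quantity, for the free propagator `G_j` ON THE TORUS,
  with constants depending on `d, a₋, a₊, m²₊` only: UNIFORM in `j` (through `n`), in the mass, in the fine offset `τ` and in the
  VOLUME (period vector).  ONLY HYPOTHESIS: `0 < a₋`;
* `kernel248_torusKernel_decay` — the centred form (`2|x⁰_μ| ≤ N_μ` ⇒ rate in `|x⁰|_∞`).

DICTIONARY / HONEST SCOPE.  (i) The separation of the printed kernel is `x − y = (x⁰ − y) + τ/n` with `|τ/n|_∞ < 1`, so a bound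
`e^{−κ′·dist_T(x⁰−y, 0)}` is a bound `e^{κ′}·e^{−κ′·dist_T(x, y)}` in the fine-torus distance — the constant absorbs it; we state the
decay in the unit-torus metric of `x⁰ − y`.  (ii) That the resolvent `(−Δ^ξ + m² + a Q_j^*Q_j)⁻¹Q_j^*` ON THE TORUS has the kernel
`torusKernel248` is the finite-Fourier version of the computation (2.44)–(2.47) (unit-lattice translation invariance; B5 p. 25
l. 35–36); like `B5Torus145Decay` for (1.45), this module starts from the momentum formula and does not re-derive it from the
operator.  (iii) B4 itself needs (2.35) on parallelepipeds `□` with Neumann conditions, obtained from `ξZ^d` by reflections (2.42),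
p. 584 — NOT the torus; the torus case is the one consumed by B5/B6 (B5 p. 25, p. 36).  NOT covered: the `∂^ξ_μ` and Hölder parts of
(2.35)/(2.36), (2.37), the reflection formula (2.42), the operator-level identity (ii), the `η`-rescaling.  Value = kernel
certificate (joiner) of a located by-reference step, NOT summit progress.  Unit b2b-balaban-b04-g4 (paper sub-cell B04 gen 4); staged
byte-identically under `HOME/lean/BalabanYm4/`.
-/

namespace Literature.MathematicalPhysics.QuantumFieldTheory.Balaban1983to89.B4Torus248Decay

open Complex Set UnitAddTorus
open Literature.MathematicalPhysics.QuantumFieldTheory.Balaban1983to89.B4Strip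
open Literature.MathematicalPhysics.QuantumFieldTheory.Balaban1983to89.B4StripCauchy
open Literature.MathematicalPhysics.QuantumFieldTheory.Balaban1983to89.B5Strip145Analytic
open Literature.MathematicalPhysics.QuantumFieldTheory.Balaban1983to89.B4StripSums
open Literature.MathematicalPhysics.QuantumFieldTheory.Balaban1983to89.B4ContourShift
open Literature.MathematicalPhysics.QuantumFieldTheory.Balaban1983to89.B4TorusKernel
open scoped Real

noncomputable section

variable {d : ℕ}

/-- THE FINITE-TORUS KERNEL OF `G_jQ_j^*` (B4 (2.48) on the unit torus `Π_μ ℤ/N_μ` of blocks, fine offset `τ`): at block separation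
`x⁰ ∈ ℤ^{d+1}`, `(Π_μ N_μ)^{-1} Σ_{k ∈ Π_μ ℤ/N_μ} G_{n,a,m²,τ}(p′_k) e^{i p′_k · x⁰}`, `p′_{k,μ} = 2π rep(k_μ/N_μ) ∈ (2π/N_μ)ℤ ∩ [−π,π)`.
[cite: Balaban1983RegularityDecay, (2.48) p.585 with p.572 (torus) and Balaban1984PropagatorsI p.23 (1.29), p.25 l.35–36; dictionary]
[folklore] -/
def torusKernel248 (n : ℕ) [NeZero n] (a m2 : ℝ) (τ : Fin (d + 1) → Fin n) (N : Fin (d + 1) → ℕ)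
    (x : Fin (d + 1) → ℤ) : ℂ :=
  (∏ i, ((N i : ℕ) : ℂ))⁻¹ * ∑ k : (i : Fin (d + 1)) → Fin (N i),
    G n a m2 τ (ofRealVec (fun i => 2 * π * rep (MultiPeriod.gridPt N k i))) * mFourier x (MultiPeriod.gridPt N k)

/-- the finite-torus kernel is the engine's `MultiPeriod.torusKernel` of the descended multiplier (definitional). [folklore] -/
theorem torusKernel248_eq_torusKernel (n : ℕ) [NeZero n] (a m2 : ℝ) (τ : Fin (d + 1) → Fin n) {κ M : ℝ}
    (hreg : StripRegular (d := d) (G n a m2 τ) κ M) (hκ : 0 ≤ κ) (N : Fin (d + 1) → ℕ) (x : Fin (d + 1) → ℤ) :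
    torusKernel248 n a m2 τ N x = MultiPeriod.torusKernel (descendC _ hreg hκ) N x := rfl

/-- PERIODICITY: `torusKernel248 … N (x + (N_μ m_μ)_μ) = torusKernel248 … N x` (the grid characters are `N_μ`-periodic).
[folklore] -/
theorem torusKernel248_translate (n : ℕ) [NeZero n] (a m2 : ℝ) (τ : Fin (d + 1) → Fin n) {N : Fin (d + 1) → ℕ}
    (hN : ∀ i, 1 ≤ N i) (x m : Fin (d + 1) → ℤ) :
    torusKernel248 n a m2 τ N (MultiPeriod.translate N x m) = torusKernel248 n a m2 τ N x := by
  unfold torusKernel248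
  congr 1
  exact Finset.sum_congr rfl fun k _ => by rw [MultiPeriod.mFourier_translate_gridPt hN x m k]

/-- for fixed admissible parameters `a > 0`, `m² ≥ 0` the (2.48) multiplier is strip regular with a POSITIVE half-width, for every
`n ≥ 1` and every offset `τ` (the uniform family of `B4StripSums.multiplier248_stripRegular` at `a₋ = a₊ = a`, `m²₊ = m²`).
[folklore] -/
theorem exists_stripRegular_G {a m2 : ℝ} (ha : 0 < a) (hm : 0 ≤ m2) :
    ∃ κ M : ℝ, 0 < κ ∧ 0 ≤ M ∧ ∀ (n : ℕ) [NeZero n] (τ : Fin (d + 1) → Fin n),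
      StripRegular (d := d) (G n a m2 τ) κ M := by
  obtain ⟨κ, M, hκ, hM, h⟩ := multiplier248_stripRegular d a a m2 ha
  exact ⟨κ, M, hκ, hM, fun n _ τ => h n a m2 le_rfl le_rfl hm le_rfl τ⟩

/-- **"RELATING G ON THE TORUS TO G ON THE WHOLE LATTICE IN THE USUAL WAY"** (B5 p. 36 l. 20–23) for `G_jQ_j^*`: the finite-torus
kernel of (2.48) is the periodisation of the infinite-volume kernel of (2.48),
`torusKernel248 n a m2 τ N x⁰ = Σ_{m ∈ ℤ^{d+1}} latticeKernel (G n a m2 τ) (x⁰ + (N_μ m_μ)_μ)`, for every `a > 0`, `m² ≥ 0`, `n ≥ 1`,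
`τ`, all `N_μ ≥ 1`, `x⁰`. [cite: Balaban1984PropagatorsI, p. 36 l. 20–23; Balaban1983RegularityDecay (2.48) p.585; proof supplied by
the audit, not printed] -/
theorem torusKernel248_eq_periodise (n : ℕ) [NeZero n] {a m2 : ℝ} (ha : 0 < a) (hm : 0 ≤ m2)
    (τ : Fin (d + 1) → Fin n) {N : Fin (d + 1) → ℕ} (hN : ∀ i, 1 ≤ N i) (x : Fin (d + 1) → ℤ) :
    torusKernel248 n a m2 τ N x
      = ∑' m : Fin (d + 1) → ℤ, latticeKernel (G n a m2 τ) (MultiPeriod.translate N x m) := by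
  obtain ⟨κ, M, hκ, _, hreg⟩ := exists_stripRegular_G (d := d) ha hm
  rw [torusKernel248_eq_torusKernel n a m2 τ (hreg n τ) hκ.le N x]
  exact MultiPeriod.torusKernel_descend_eq (hreg n τ) hκ hN x

/-- **B4 LEMMA 2.4 (2.35), FIRST QUANTITY, ON THE TORUS — UNIFORMLY IN `j`, THE MASS, THE OFFSET AND THE VOLUME.**  For
`0 < a₋ ≤ a₊`, `m²₊` there are `κ > 0` and `M ≥ 0`, depending on `d, a₋, a₊, m²₊` only, such that for EVERY `n = L^j ≥ 1`, every
`a ∈ [a₋, a₊]`, every `m² ∈ [0, m²₊]`, every fine offset `τ ∈ {0..n−1}^{d+1}`, every period vector with all `N_μ ≥ 1` and EVERY block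
separation `x⁰ ∈ ℤ^{d+1}`:
`‖torusKernel248 n a m2 τ N x⁰‖ ≤ M · periodConst κ d · e^{−(κ/(d+1)) · torusSupNorm N x⁰}`,
`MultiPeriod.torusSupNorm N x⁰ = max_μ dist(x⁰_μ, N_μℤ)` the sup-distance on the unit torus `Π_μ ℤ/N_μ` between the classes of `x⁰`
and `0`.  ONLY HYPOTHESIS: `0 < a₋`.  Assembled from `B4StripSums.multiplier248_stripRegular` (the (2.48) multiplier is strip regular,
uniformly) and the generic engines `B4ContourShift` (contour shift) / `B4TorusKernel` (Poisson periodisation, torus metric).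
[cite: Balaban1983RegularityDecay, Lemma 2.4 (2.35) p.582 with (2.48) p.585 and p.586 l.9–15; Balaban1984PropagatorsI p.25 l.35–36,
p.36 l.20–23; proof supplied by the audit, not printed] -/
theorem kernel248_torusKernel_decay_torusMetric (d : ℕ) (aminus aplus m2plus : ℝ) (ha : 0 < aminus) :
    ∃ κ M : ℝ, 0 < κ ∧ 0 ≤ M ∧ ∀ (n : ℕ) [NeZero n] (a m2 : ℝ), aminus ≤ a → a ≤ aplus → 0 ≤ m2 →
      m2 ≤ m2plus → ∀ (τ : Fin (d + 1) → Fin n) (N : Fin (d + 1) → ℕ), (∀ i, 1 ≤ N i) →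
        ∀ x : Fin (d + 1) → ℤ,
          ‖torusKernel248 n a m2 τ N x‖
            ≤ M * periodConst κ d * Real.exp (-(κ / (d + 1) * MultiPeriod.torusSupNorm N x)) := by
  obtain ⟨κ, M, hκ, hM, h⟩ := multiplier248_stripRegular d aminus aplus m2plus ha
  refine ⟨κ, M, hκ, hM, ?_⟩
  intro n _ a m2 ha1 ha2 hm hmp τ N hN x
  have hreg := h n a m2 ha1 ha2 hm hmp τ
  rw [torusKernel248_eq_torusKernel n a m2 τ hreg hκ.le N x]
  exact MultiPeriod.torusKernel_descend_decay_torusMetric hreg hκ hN x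

/-- the centred form: for centred representatives (`2|x⁰_μ| ≤ N_μ`) the decay is in the lattice sup norm `|x⁰|_∞`, same constants.
[cite: Balaban1983RegularityDecay, Lemma 2.4 (2.35) p.582; proof supplied by the audit, not printed] -/
theorem kernel248_torusKernel_decay (d : ℕ) (aminus aplus m2plus : ℝ) (ha : 0 < aminus) :
    ∃ κ M : ℝ, 0 < κ ∧ 0 ≤ M ∧ ∀ (n : ℕ) [NeZero n] (a m2 : ℝ), aminus ≤ a → a ≤ aplus → 0 ≤ m2 →
      m2 ≤ m2plus → ∀ (τ : Fin (d + 1) → Fin n) (N : Fin (d + 1) → ℕ), (∀ i, 1 ≤ N i) →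
        ∀ x : Fin (d + 1) → ℤ, (∀ i, 2 * |x i| ≤ N i) →
          ‖torusKernel248 n a m2 τ N x‖ ≤ M * periodConst κ d * Real.exp (-(κ / (d + 1) * supNorm x)) := by
  obtain ⟨κ, M, hκ, hM, h⟩ := kernel248_torusKernel_decay_torusMetric d aminus aplus m2plus ha
  refine ⟨κ, M, hκ, hM, ?_⟩
  intro n _ a m2 ha1 ha2 hm hmp τ N hN x hx
  rw [← MultiPeriod.torusSupNorm_of_centred hN hx]
  exact h n a m2 ha1 ha2 hm hmp τ N hN x

/-- the periodisation series of the (2.48) lattice kernel converges absolutely and obeys the same torus bound — the form in which a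
consumer who starts from the infinite-volume kernel `latticeKernel (G n a m2 τ)` (B4StripSums.kernel248_decay) reads the torus
statement. [cite: Balaban1984PropagatorsI, p. 36 l. 20–23; proof supplied by the audit, not printed] -/
theorem kernel248_periodise_decay (d : ℕ) (aminus aplus m2plus : ℝ) (ha : 0 < aminus) :
    ∃ κ M : ℝ, 0 < κ ∧ 0 ≤ M ∧ ∀ (n : ℕ) [NeZero n] (a m2 : ℝ), aminus ≤ a → a ≤ aplus → 0 ≤ m2 →
      m2 ≤ m2plus → ∀ (τ : Fin (d + 1) → Fin n) (N : Fin (d + 1) → ℕ), (∀ i, 1 ≤ N i) →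
        ∀ x : Fin (d + 1) → ℤ,
          ‖∑' m : Fin (d + 1) → ℤ, latticeKernel (G n a m2 τ) (MultiPeriod.translate N x m)‖
            ≤ M * periodConst κ d * Real.exp (-(κ / (d + 1) * MultiPeriod.torusSupNorm N x)) := by
  obtain ⟨κ, M, hκ, hM, h⟩ := kernel248_torusKernel_decay_torusMetric d aminus aplus m2plus ha
  refine ⟨κ, M, hκ, hM, ?_⟩
  intro n _ a m2 ha1 ha2 hm hmp τ N hN x
  rw [← torusKernel248_eq_periodise n (lt_of_lt_of_le ha ha1) hm τ hN x]
  exact h n a m2 ha1 ha2 hm hmp τ N hN x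

end

end Literature.MathematicalPhysics.QuantumFieldTheory.Balaban1983to89.B4Torus248Decay
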